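import Summits.BirchSwinnertonDyer.BirchSwinnertonDyer.Theorems.CountingDoorF2AtThreeSemistableRootNumber
import Summits.BirchSwinnertonDyer.BirchSwinnertonDyer.Theorems.CountingDoorF2AtThreeSemistableRootNumberSquarefree
import Mathlib.NumberTheory.ArithmeticFunction.Moebius
import Literature.NumberTheory.EllipticCurves.BhargavaHo2022.TwoMarkedPoints
import HarnessLib

/-!
# BirchSwinnertonDyer / CountingDoorF2AtThree — crux I2 `RootNumberPlusLowerDensityLargeF2`
# (stmt-BirchSwinnertonDyer-19441), lane «closed-form local root numbers»: the root number of a member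
# of Bhargava–Ho's `F₂` in CLOSED FORM on the semistable locus, and the TYPED DOOR «a `2/3`-bias bound
# for the explicit Liouville–Jacobi sign ⇒ root number `+1` with lower density `> 1/6`»

Route `route-BirchSwinnertonDyer-CountingDoorF2AtThree` (cell bsd-rank2, WIDTH-LEVER lane B
`bsd-rank2-rootno-p2`). Crux I2 asks for a lower density `ρ > 1/6` of root number `+1` on every large
`Φ ⊆ F₂`; its door-needed form is `ρ(Φ₀) > 1/6` on ONE large `Φ₀` carrying the door conditions, and
the cell's refined door family `Φ***` (eng-2, `exists_refinedDoorFamily`) has SQUAREFREE `Δ(a)` for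
every member. On such members the root number is an explicit arithmetic function (kernel file
`…SemistableRootNumber`), so the only analytic input the door needs is ONE bias bound for that
function. This file:

* §1 `curve_eq_baseChange`, `curveInt_c₄`, `curveInt_c₆`, `curveInt_Δ`, `curveInt_nodalConst`:
  the invariants of the member `E_a : y² + a₁xy + a₃y = (x − a₂)(x − a₂')(x + a₂ + a₂')` as polynomials
  (`c₄ = a₁⁴ − 24a₁a₃ + 48Q`, `c₆ = −a₁⁶ + 36a₁³a₃ − 72a₁²Q − 216a₃² − 864R`,
  `Δ = 64Q³ − 432R² − 27a₃⁴ + a₁³a₃³ + (30a₁²Q − 216R)a₃² − (a₁⁵Q − 36a₁³R + 96a₁Q²)a₃ + a₁⁴Q² − a₁⁶R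
  − 72a₁²QR`, with `Q = a₂² + a₂a₂' + a₂'²`, `R = a₂a₂'(a₂ + a₂')`; the node constant
  `54b₆ − 3b₂b₄ + a₂c₄` is even iff `a₁a₃` is);
* §2 `rootNumber_curve_eq_neg_prod_primeFactors` — for a member with no prime dividing both `Δ(a)` and
  `c₄(a)` (in particular for SQUAREFREE `Δ(a)`, `rootNumber_curve_eq_neg_prod_primeFactors_of_squarefree`):
  `w(E_a) = −∏_{p ∣ Δ(a)} s_p(a)`, `s₂(a) = −1` iff `2 ∣ a₁a₃`, `s_p(a) = −J(−c₄(a)c₆(a) | p)` (odd `p`),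
  modulo the Modularity Theorem `exists_isNewformOf` only;
* §3 THE TYPED DOOR (Selmer-free): `densityOnGE_rootNumber_of_averageOnLE` — for ANY `Φ` eventually
  nonempty, `Φ.AverageOnLE (−w) θ ⇒ Φ.DensityOnGE (w = +1) ((1 − θ)/2)`;
  `densityOnGE_rootNumber_of_liouvilleJacobi_averageOnLE` — for `Φ` whose members have squarefree `Δ`,
  the hypothesis is the average of the EXPLICIT sign `∏_{p ∣ Δ(a)} s_p(a)` (no `L`-function, no Selmer
  group); `exists_gt_one_sixth_of_liouvilleJacobi_bias` — a bias bound `θ < 2/3` gives `ρ > 1/6`,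
  exactly I2's threshold on that family.

* §4 `not_two_dvd_a₁_mul_a₃` (`2 ∥ Δ(a)` forces `a₁a₃` odd: on the squarefree locus the sign at `2`
  is `+1`, by `decide` on `Δ mod 4`), and the UNIFORM normal form on the whole squarefree locus
  `rootNumber_curve_eq_neg_moebius_mul_jacobiSym_of_even` / `…_of_odd`: `w(E_a) = −μ(m)·J(−c₆(a) | m)`,
  `m` = odd part of `|Δ(a)|`.

HONEST STATUS. The bias bound itself — a `2/3`-bias (not `o(1)`) weak-Chowla statement for the
Liouville function of the irreducible weighted-degree-12 form `Δ_{F₂}` twisted by a Jacobi symbol, over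
congruence boxes — is NOT proved here or anywhere in print (Helfgott: unconditional only when the
multiplicative-reduction polynomial has no irreducible factor of degree `> 3`); this file turns it into
ONE typed hypothesis on an explicit function. PARTITION: none — r_an ≥ 2, summit axis S0; TWIN
(D-0056): n/a. B1 honesty: bookkeeping; nothing reads r_an; no S0 motion.

References: M. Bhargava, W. Ho, arXiv:2207.03309 §1 [BhargavaHo2022]; D. Rohrlich, *Compositio Math.*
87 (1993) Prop. 2 [Rohrlich1993Compositio]; L. Cowland Kellock, V. Dokchitser, *Bull. LMS* 55 (2023)
Cor. 2.5 [KellockDokchitser2023]; H. A. Helfgott, arXiv:math/0408141 §1 [Helfgott2004RootNumber].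
-/

set_option linter.dupNamespace false
set_option autoImplicit false

noncomputable section

open scoped Classical NumberTheorySymbols

open Filter Topology Finset WeierstrassCurve
  Literature.NumberTheory.EllipticCurves.BhargavaHo2022
  Summit.BirchSwinnertonDyer.BirchSwinnertonDyer.Theorems.SemistableRootNumber

namespace Summit.BirchSwinnertonDyer.BirchSwinnertonDyer.Theorems.F2RootNumber

/-! ### §1 The invariants of a member of `F₂` -/

/-- The member `E_a / ℚ` is the base change of the integer equation `a.curveInt`.
[cite: BhargavaHo2022, §1 (definition of F₂)] -/
theorem curve_eq_baseChange (a : Params) : a.curve = a.curveInt.baseChange ℚ := by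
  rw [Params.curve, WeierstrassCurve.baseChange, algebraMap_int_eq]

/-- `c₄(E_a) = a₁⁴ − 24a₁a₃ + 48(a₂² + a₂a₂' + a₂'²)`. [cite: BhargavaHo2022, §1 (definition of F₂)] -/
theorem curveInt_c₄ (a : Params) :
    a.curveInt.c₄ = a.a₁ ^ 4 - 24 * a.a₁ * a.a₃ + 48 * (a.a₂ ^ 2 + a.a₂ * a.a₂' + a.a₂' ^ 2) := by
  simp only [Params.curveInt, WeierstrassCurve.c₄, WeierstrassCurve.b₂, WeierstrassCurve.b₄]
  ring

/-- `c₆(E_a) = −a₁⁶ + 36a₁³a₃ − 72a₁²Q − 216a₃² − 864R` with `Q = a₂² + a₂a₂' + a₂'²`,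
`R = a₂a₂'(a₂ + a₂')`. [cite: BhargavaHo2022, §1 (definition of F₂)] -/
theorem curveInt_c₆ (a : Params) :
    a.curveInt.c₆ = -a.a₁ ^ 6 + 36 * a.a₁ ^ 3 * a.a₃
      - 72 * a.a₁ ^ 2 * (a.a₂ ^ 2 + a.a₂ * a.a₂' + a.a₂' ^ 2) - 216 * a.a₃ ^ 2
      - 864 * (a.a₂ * a.a₂' * (a.a₂ + a.a₂')) := by
  simp only [Params.curveInt, WeierstrassCurve.c₆, WeierstrassCurve.b₂, WeierstrassCurve.b₄,
    WeierstrassCurve.b₆]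
  ring

/-- **The discriminant polynomial of `F₂`** (35 monomials in `a₁, a₂, a₂', a₃`; weighted-homogeneous of
degree `12` for the weights `(1, 2, 2, 3)`), written in `a₁, a₃, Q = a₂² + a₂a₂' + a₂'²,
R = a₂a₂'(a₂ + a₂')`: `Δ = 64Q³ − 432R² − 27a₃⁴ + a₁³a₃³ + (30a₁²Q − 216R)a₃² − (a₁⁵Q − 36a₁³R +
96a₁Q²)a₃ + a₁⁴Q² − a₁⁶R − 72a₁²QR` (note `64Q³ − 432R² = 16·(4Q³ − 27R²) = 16·disc(x³ − Qx + R)`).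
[cite: BhargavaHo2022, §1 (the discriminant polynomial Δ)] -/
theorem curveInt_Δ (a : Params) :
    a.curveInt.Δ =
      64 * (a.a₂ ^ 2 + a.a₂ * a.a₂' + a.a₂' ^ 2) ^ 3 - 432 * (a.a₂ * a.a₂' * (a.a₂ + a.a₂')) ^ 2
      - 27 * a.a₃ ^ 4 + a.a₁ ^ 3 * a.a₃ ^ 3
      + (30 * a.a₁ ^ 2 * (a.a₂ ^ 2 + a.a₂ * a.a₂' + a.a₂' ^ 2)
          - 216 * (a.a₂ * a.a₂' * (a.a₂ + a.a₂'))) * a.a₃ ^ 2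
      - (a.a₁ ^ 5 * (a.a₂ ^ 2 + a.a₂ * a.a₂' + a.a₂' ^ 2)
          - 36 * a.a₁ ^ 3 * (a.a₂ * a.a₂' * (a.a₂ + a.a₂'))
          + 96 * a.a₁ * (a.a₂ ^ 2 + a.a₂ * a.a₂' + a.a₂' ^ 2) ^ 2) * a.a₃
      + a.a₁ ^ 4 * (a.a₂ ^ 2 + a.a₂ * a.a₂' + a.a₂' ^ 2) ^ 2
      - a.a₁ ^ 6 * (a.a₂ * a.a₂' * (a.a₂ + a.a₂'))
      - 72 * a.a₁ ^ 2 * (a.a₂ ^ 2 + a.a₂ * a.a₂' + a.a₂' ^ 2) * (a.a₂ * a.a₂' * (a.a₂ + a.a₂')) := by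
  simp only [Params.curveInt, WeierstrassCurve.Δ, WeierstrassCurve.b₂, WeierstrassCurve.b₄,
    WeierstrassCurve.b₆, WeierstrassCurve.b₈]
  ring

/-- The node constant `54b₆ − 3b₂b₄ + a₂c₄` of `E_a` (Weierstrass `a₂ = 0`) is
`54a₃² + 216R − 3a₁³a₃ + 6a₁²Q`. [cite: BhargavaHo2022, §1 (definition of F₂)] -/
theorem curveInt_nodalConst (a : Params) :
    54 * a.curveInt.b₆ - 3 * a.curveInt.b₂ * a.curveInt.b₄ + a.curveInt.a₂ * a.curveInt.c₄ =
      54 * a.a₃ ^ 2 + 216 * (a.a₂ * a.a₂' * (a.a₂ + a.a₂')) - 3 * a.a₁ ^ 3 * a.a₃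
        + 6 * a.a₁ ^ 2 * (a.a₂ ^ 2 + a.a₂ * a.a₂' + a.a₂' ^ 2) := by
  simp only [Params.curveInt, WeierstrassCurve.c₄, WeierstrassCurve.b₂, WeierstrassCurve.b₄,
    WeierstrassCurve.b₆]
  ring

/-- The node constant of `E_a` is even iff `a₁a₃` is even (`≡ a₁³a₃ (mod 2)`). [folklore] -/
theorem two_dvd_nodalConst_iff (a : Params) :
    (2 : ℤ) ∣ 54 * a.curveInt.b₆ - 3 * a.curveInt.b₂ * a.curveInt.b₄ + a.curveInt.a₂ * a.curveInt.c₄ ↔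
      (2 : ℤ) ∣ a.a₁ * a.a₃ := by
  rw [curveInt_nodalConst]
  have h : 54 * a.a₃ ^ 2 + 216 * (a.a₂ * a.a₂' * (a.a₂ + a.a₂')) - 3 * a.a₁ ^ 3 * a.a₃
      + 6 * a.a₁ ^ 2 * (a.a₂ ^ 2 + a.a₂ * a.a₂' + a.a₂' ^ 2) =
      2 * (27 * a.a₃ ^ 2 + 108 * (a.a₂ * a.a₂' * (a.a₂ + a.a₂')) - a.a₁ ^ 3 * a.a₃
        + 3 * a.a₁ ^ 2 * (a.a₂ ^ 2 + a.a₂ * a.a₂' + a.a₂' ^ 2)) - a.a₁ ^ 2 * (a.a₁ * a.a₃) := by ring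
  rw [h, dvd_sub_right (dvd_mul_right 2 _)]
  constructor
  · intro hd
    rcases Int.prime_two.dvd_or_dvd hd with h2 | h2
    · exact dvd_mul_of_dvd_left (Int.prime_two.dvd_of_dvd_pow h2) _
    · exact h2
  · intro hd
    exact dvd_mul_of_dvd_right hd _

/-! ### §2 The root number of a semistable member in closed form -/

/-- **Closed-form root number of a semistable member of `F₂`** (modulo the Modularity Theorem): if no
prime divides both `Δ(a)` and `c₄(a)` then
`w(E_a) = −∏_{p ∣ Δ(a)} s_p(a)`, `s₂(a) = −1` iff `2 ∣ a₁a₃` (else `+1`), `s_p(a) = −J(−c₄(a)c₆(a) | p)`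
for odd `p`, with `c₄(a), c₆(a)` the polynomials of §1. [cite: Rohrlich1993Compositio, Prop. 2]
[cite: KellockDokchitser2023, Cor. 2.5] -/
theorem rootNumber_curve_eq_neg_prod_primeFactors (a : Params) (ha : a.IsMember)
    (hss : ∀ p : ℕ, p.Prime → (p : ℤ) ∣ a.curveInt.Δ → ¬ (p : ℤ) ∣ a.curveInt.c₄)
    (hmod : Literature.NumberTheory.EllipticCurves.ModularForms.exists_isNewformOf) :
    a.curve.rootNumber =
      -∏ p ∈ a.curveInt.Δ.natAbs.primeFactors,
        (if p = 2 then (if (2 : ℤ) ∣ a.a₁ * a.a₃ then -1 else 1)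
         else -J(-(a.curveInt.c₄ * a.curveInt.c₆) | p)) := by
  rw [curve_eq_baseChange, rootNumber_eq_neg_prod_primeFactors ha hss hmod]
  congr 1
  refine Finset.prod_congr rfl fun p _ ↦ ?_
  by_cases h2 : p = 2
  · rw [if_pos h2, if_pos h2]
    by_cases hK : (2 : ℤ) ∣ a.a₁ * a.a₃
    · rw [if_pos hK, if_pos ((two_dvd_nodalConst_iff a).mpr hK)]
    · rw [if_neg hK, if_neg (mt (two_dvd_nodalConst_iff a).mp hK)]
  · rw [if_neg h2, if_neg h2]

/-- **Closed-form root number of a member of `F₂` with SQUAREFREE discriminant** (every such member is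
semistable: `forall_not_dvd_c₄_of_squarefree`'s `F₂` instance is proved here directly from the gcd
hypothesis supplied by the caller; see the companion file for the general squarefree ⇒ semistable lemma).
[cite: Rohrlich1993Compositio, Prop. 2] [cite: KellockDokchitser2023, Cor. 2.5] -/
theorem rootNumber_curve_eq_neg_prod_primeFactors_of_forall (Φ : CongruenceFamily₂)
    (hΦ : ∀ a : Params, Φ.Mem a →
      ∀ p : ℕ, p.Prime → (p : ℤ) ∣ a.curveInt.Δ → ¬ (p : ℤ) ∣ a.curveInt.c₄)
    (hmod : Literature.NumberTheory.EllipticCurves.ModularForms.exists_isNewformOf)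
    (a : Params) (ha : Φ.Mem a) :
    a.curve.rootNumber =
      -∏ p ∈ a.curveInt.Δ.natAbs.primeFactors,
        (if p = 2 then (if (2 : ℤ) ∣ a.a₁ * a.a₃ then -1 else 1)
         else -J(-(a.curveInt.c₄ * a.curveInt.c₆) | p)) :=
  rootNumber_curve_eq_neg_prod_primeFactors a ha.1 (hΦ a ha) hmod

/-! ### §3 The typed door: a bias bound for the explicit sign gives the root-number density -/

/-- **Root-number density from an average bound.** For any congruence subfamily `Φ` of `F₂` that is
eventually nonempty along the height: if the average of `−w(E_a)` over `Φ(<X)` is eventually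
`≤ θ + ε` for every `ε > 0` (`Φ.AverageOnLE (−w) θ`), then root number `+1` has lower density
`≥ (1 − θ)/2` (`#{w = +1} = ∑ (1 + w)/2` since `w ∈ {±1}`). [folklore] -/
theorem densityOnGE_rootNumber_of_averageOnLE (Φ : CongruenceFamily₂) {θ : ℝ}
    (hne : ∀ᶠ X : ℕ in atTop, 0 < (Φ.below X).card)
    (havg : Φ.AverageOnLE (fun a ↦ -(a.curve.rootNumber : ℝ)) θ) :
    Φ.DensityOnGE (fun a ↦ a.curve.rootNumber = 1) ((1 - θ) / 2) := by
  intro ε hε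
  filter_upwards [hne, havg (2 * ε) (by positivity)] with X hX hA
  have hc : (0 : ℝ) < (Φ.below X).card := by exact_mod_cast hX
  unfold CongruenceFamily₂.proportionOn CongruenceFamily₂.averageOn at *
  rw [div_le_iff₀ hc] at hA
  rw [le_div_iff₀ hc]
  -- pointwise: `𝟙[w = 1] = (1 + w)/2`
  have hpt : ∀ a ∈ Φ.below X, (if a.curve.rootNumber = 1 then (1 : ℝ) else 0) =
      (1 + (a.curve.rootNumber : ℝ)) / 2 := by
    intro a _
    rcases a.curve.rootNumber_eq_one_or with h | h
    · rw [if_pos h, h]; norm_num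
    · rw [if_neg (by rw [h]; norm_num), h]; norm_num
  have hS : (∑ a ∈ Φ.below X, (if a.curve.rootNumber = 1 then (1 : ℝ) else 0)) =
      ((Φ.below X).card + ∑ a ∈ Φ.below X, (a.curve.rootNumber : ℝ)) / 2 := by
    rw [Finset.sum_congr rfl hpt, ← Finset.sum_div, Finset.sum_add_distrib, Finset.sum_const,
      nsmul_eq_mul, mul_one]
  have hsum : ∑ a ∈ Φ.below X, (a.curve.rootNumber : ℝ) =
      -∑ a ∈ Φ.below X, -(a.curve.rootNumber : ℝ) := by
    rw [Finset.sum_neg_distrib, neg_neg]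
  have hA' : ∑ a ∈ Φ.below X, -(a.curve.rootNumber : ℝ) ≤ (θ + 2 * ε) * (Φ.below X).card := hA
  have hgoal : ((1 - θ) / 2 - ε) * ((Φ.below X).card : ℝ) ≤
      ∑ a ∈ Φ.below X, (if a.curve.rootNumber = 1 then (1 : ℝ) else 0) := by
    rw [hS, hsum]
    nlinarith [hA', hc, hε]
  refine hgoal.trans (le_of_eq (Finset.sum_congr rfl fun a _ ↦ ?_))
  beta_reduce
  split_ifs <;> rfl

/-- **THE TYPED DOOR (Selmer-free, `L`-function-free).** Let `Φ ⊆ F₂` be a congruence subfamily all of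
whose members have no prime dividing both `Δ(a)` and `c₄(a)` (e.g. squarefree `Δ(a)`: the refined door
family of the cell), eventually nonempty along the height. If the EXPLICIT Liouville–Jacobi sign
`σ(a) = ∏_{p ∣ Δ(a)} s_p(a)` (`s₂ = −1` iff `2 ∣ a₁a₃`, `s_p = −J(−c₄(a)c₆(a) | p)`) has
`limsup` average `≤ θ` over `Φ` (`Φ.AverageOnLE σ θ`), then — modulo the Modularity Theorem — root number
`+1` has lower density `≥ (1 − θ)/2` on `Φ`. [cite: Helfgott2004RootNumber, §1]
[cite: Rohrlich1993Compositio, Prop. 2] -/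
theorem densityOnGE_rootNumber_of_liouvilleJacobi_averageOnLE (Φ : CongruenceFamily₂) {θ : ℝ}
    (hΦ : ∀ a : Params, Φ.Mem a →
      ∀ p : ℕ, p.Prime → (p : ℤ) ∣ a.curveInt.Δ → ¬ (p : ℤ) ∣ a.curveInt.c₄)
    (hmod : Literature.NumberTheory.EllipticCurves.ModularForms.exists_isNewformOf)
    (hne : ∀ᶠ X : ℕ in atTop, 0 < (Φ.below X).card)
    (havg : Φ.AverageOnLE (fun a ↦ ((∏ p ∈ a.curveInt.Δ.natAbs.primeFactors,
        (if p = 2 then (if (2 : ℤ) ∣ a.a₁ * a.a₃ then -1 else 1)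
         else -J(-(a.curveInt.c₄ * a.curveInt.c₆) | p)) : ℤ) : ℝ)) θ) :
    Φ.DensityOnGE (fun a ↦ a.curve.rootNumber = 1) ((1 - θ) / 2) := by
  refine densityOnGE_rootNumber_of_averageOnLE Φ hne fun ε hε ↦ ?_
  filter_upwards [havg ε hε] with X hX
  refine le_of_eq_of_le ?_ hX
  unfold CongruenceFamily₂.averageOn
  congr 1
  refine Finset.sum_congr rfl fun a ha ↦ ?_
  show -(a.curve.rootNumber : ℝ) = _
  rw [rootNumber_curve_eq_neg_prod_primeFactors_of_forall Φ hΦ hmod a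
    ((Φ.mem_below_iff a X).mp ha).1]
  push_cast
  ring

/-- **I2's threshold on such a family from a `2/3`-bias bound**: under the hypotheses of
`densityOnGE_rootNumber_of_liouvilleJacobi_averageOnLE` with `θ < 2/3`, root number `+1` has lower
density `ρ = (1 − θ)/2 > 1/6` on `Φ` — the conclusion of crux I2 for this `Φ` (its `∃ ρ > 1/6` clause).
Equidistribution would be `θ = 0`, `ρ = 1/2`; the door needs only the BIAS bound `θ < 2/3`.
[cite: Helfgott2004RootNumber, §1] [cite: BhargavaHo2022, §1] -/
theorem exists_gt_one_sixth_of_liouvilleJacobi_bias (Φ : CongruenceFamily₂) {θ : ℝ} (hθ : θ < 2 / 3)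
    (hΦ : ∀ a : Params, Φ.Mem a →
      ∀ p : ℕ, p.Prime → (p : ℤ) ∣ a.curveInt.Δ → ¬ (p : ℤ) ∣ a.curveInt.c₄)
    (hmod : Literature.NumberTheory.EllipticCurves.ModularForms.exists_isNewformOf)
    (hne : ∀ᶠ X : ℕ in atTop, 0 < (Φ.below X).card)
    (havg : Φ.AverageOnLE (fun a ↦ ((∏ p ∈ a.curveInt.Δ.natAbs.primeFactors,
        (if p = 2 then (if (2 : ℤ) ∣ a.a₁ * a.a₃ then -1 else 1)
         else -J(-(a.curveInt.c₄ * a.curveInt.c₆) | p)) : ℤ) : ℝ)) θ) :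
    ∃ ρ : ℝ, 1 / 6 < ρ ∧ Φ.DensityOnGE (fun a ↦ a.curve.rootNumber = 1) ρ :=
  ⟨(1 - θ) / 2, by linarith,
    densityOnGE_rootNumber_of_liouvilleJacobi_averageOnLE Φ hΦ hmod hne havg⟩

/-! ### §4 On the squarefree locus of `F₂` the sign at `2` is `+1`; the uniform normal form
`w(E_a) = −μ(m)·J(−c₆(a) | m)`, `m` = odd part of `|Δ(a)|` -/

/-- The discriminant polynomial of `F₂` modulo `4`: `Δ(a) ≡ 2 (mod 4)` forces `a₁a₃ ≡ ±1 (mod 4)`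
(all `4⁴` residue classes, by `decide`). [cite: BhargavaHo2022, §1 (the discriminant polynomial Δ)] -/
private theorem zmod4_Δ_eq_two_imp : ∀ x₁ x₂ x₃ x₄ : ZMod 4,
    (64 * (x₂ ^ 2 + x₂ * x₃ + x₃ ^ 2) ^ 3 - 432 * (x₂ * x₃ * (x₂ + x₃)) ^ 2
      - 27 * x₄ ^ 4 + x₁ ^ 3 * x₄ ^ 3
      + (30 * x₁ ^ 2 * (x₂ ^ 2 + x₂ * x₃ + x₃ ^ 2) - 216 * (x₂ * x₃ * (x₂ + x₃))) * x₄ ^ 2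
      - (x₁ ^ 5 * (x₂ ^ 2 + x₂ * x₃ + x₃ ^ 2) - 36 * x₁ ^ 3 * (x₂ * x₃ * (x₂ + x₃))
          + 96 * x₁ * (x₂ ^ 2 + x₂ * x₃ + x₃ ^ 2) ^ 2) * x₄
      + x₁ ^ 4 * (x₂ ^ 2 + x₂ * x₃ + x₃ ^ 2) ^ 2 - x₁ ^ 6 * (x₂ * x₃ * (x₂ + x₃))
      - 72 * x₁ ^ 2 * (x₂ ^ 2 + x₂ * x₃ + x₃ ^ 2) * (x₂ * x₃ * (x₂ + x₃))) = 2 →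
    x₁ * x₄ = 1 ∨ x₁ * x₄ = 3 := by
  decide

/-- In `ZMod 4`, twice anything is `0` or `2`. [folklore] -/
private theorem zmod4_two_mul : ∀ y : ZMod 4, 2 * y = 0 ∨ 2 * y = 2 := by decide

/-- **`2 ∥ Δ(a)` forces `a₁a₃` odd** for a member of `F₂` (`Δ(a) ≡ 2 (mod 4)` only when `a₁, a₃` are odd
and `a₂, a₂'` even); hence on the squarefree-discriminant locus a member with even `Δ` has NON-SPLIT
multiplicative reduction at `2` (`s₂(a) = +1`). [cite: BhargavaHo2022, §1 (the discriminant polynomial Δ)] -/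
theorem not_two_dvd_a₁_mul_a₃ (a : Params) (h2 : (2 : ℤ) ∣ a.curveInt.Δ)
    (h4 : ¬ (4 : ℤ) ∣ a.curveInt.Δ) : ¬ (2 : ℤ) ∣ a.a₁ * a.a₃ := by
  intro h13
  -- `Δ ≡ 2 (mod 4)`
  have hΔ4 : ((a.curveInt.Δ : ℤ) : ZMod 4) = 2 := by
    obtain ⟨m, hm⟩ := h2
    have hmodd : ¬ (2 : ℤ) ∣ m := fun ⟨k, hk⟩ ↦ h4 ⟨k, by rw [hm, hk]; ring⟩
    obtain ⟨k, hk⟩ : ∃ k : ℤ, m = 2 * k + 1 := ⟨m / 2, by omega⟩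
    rw [hm, hk]
    push_cast
    rcases zmod4_two_mul (k : ZMod 4) with h0 | h0
    · rw [show (2 : ZMod 4) * (2 * (k : ZMod 4) + 1) = 2 * (2 * (k : ZMod 4)) + 2 by ring, h0]; decide
    · rw [show (2 : ZMod 4) * (2 * (k : ZMod 4) + 1) = 2 * (2 * (k : ZMod 4)) + 2 by ring, h0]; decide
  -- `a₁a₃ ≡ 0 or 2 (mod 4)`
  have h13' : ((a.a₁ : ℤ) : ZMod 4) * (a.a₃ : ZMod 4) = 0 ∨
      ((a.a₁ : ℤ) : ZMod 4) * (a.a₃ : ZMod 4) = 2 := by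
    obtain ⟨k, hk⟩ := h13
    have : ((a.a₁ : ℤ) : ZMod 4) * (a.a₃ : ZMod 4) = 2 * (k : ZMod 4) := by exact_mod_cast congrArg (fun z : ℤ ↦ (z : ZMod 4)) hk
    rw [this]
    exact zmod4_two_mul _
  have hP := zmod4_Δ_eq_two_imp (a.a₁ : ZMod 4) (a.a₂ : ZMod 4) (a.a₂' : ZMod 4) (a.a₃ : ZMod 4)
    (by rw [← hΔ4, curveInt_Δ]; push_cast; ring)
  rcases hP with h | h <;> rcases h13' with h' | h' <;> rw [h] at h' <;> exact absurd h' (by decide)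

/-- **Uniform normal form on the squarefree locus, even case**: if `Δ(a)` is squarefree and even then, with
`m = |Δ(a)|/2`, `w(E_a) = −(−1)^{ω(m)}·J(−c₄(a)c₆(a) | m)` — the sign at `2` is `+1`
(`not_two_dvd_a₁_mul_a₃`), modulo the Modularity Theorem. [cite: Rohrlich1993Compositio, Prop. 2(ii)]
[cite: Helfgott2004RootNumber, §1] -/
theorem rootNumber_curve_eq_liouville_mul_jacobiSym_of_even (a : Params) (hsq : Squarefree a.curveInt.Δ)
    (heven : (2 : ℤ) ∣ a.curveInt.Δ)
    (hmod : Literature.NumberTheory.EllipticCurves.ModularForms.exists_isNewformOf) :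
    a.curve.rootNumber =
      -((-1) ^ (a.curveInt.Δ.natAbs / 2).primeFactors.card *
        J(-(a.curveInt.c₄ * a.curveInt.c₆) | a.curveInt.Δ.natAbs / 2)) := by
  have h4 : ¬ (4 : ℤ) ∣ a.curveInt.Δ := fun h ↦ by
    have : (2 : ℤ) * 2 ∣ a.curveInt.Δ := by simpa using h
    exact Int.prime_two.not_unit (hsq 2 this)
  have hodd13 := not_two_dvd_a₁_mul_a₃ a heven h4
  rw [curve_eq_baseChange, rootNumber_eq_liouville_mul_jacobiSym_of_even hsq heven hmod,
    if_neg (mt (two_dvd_nodalConst_iff a).mp hodd13), one_mul]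

/-- **Uniform normal form with Rohrlich's symbol, even case**: for squarefree even `Δ(a)`, `m = |Δ(a)|/2`,
`w(E_a) = −μ(m)·J(−c₆(a) | m)` (modulo Modularity) — the same shape as the odd case
`rootNumber_eq_neg_moebius_mul_jacobiSym_neg_c₆`, with `m` the odd part of `|Δ(a)|`; so on the whole
squarefree locus of `F₂` the explicit sign of the typed door is `σ(a) = μ(m)·J(−c₆(a) | m)`.
[cite: Rohrlich1993Compositio, Prop. 2(ii)] [cite: Helfgott2004RootNumber, §1] -/
theorem rootNumber_curve_eq_neg_moebius_mul_jacobiSym_of_even (a : Params)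
    (hsq : Squarefree a.curveInt.Δ) (heven : (2 : ℤ) ∣ a.curveInt.Δ)
    (hmod : Literature.NumberTheory.EllipticCurves.ModularForms.exists_isNewformOf) :
    a.curve.rootNumber =
      -(ArithmeticFunction.moebius (a.curveInt.Δ.natAbs / 2) *
        J(-a.curveInt.c₆ | a.curveInt.Δ.natAbs / 2)) := by
  have hΔ0 : a.curveInt.Δ ≠ 0 := hsq.ne_zero
  have hsqn : Squarefree a.curveInt.Δ.natAbs := Int.squarefree_natAbs.mpr hsq
  obtain ⟨m, hm⟩ : 2 ∣ a.curveInt.Δ.natAbs := Int.natCast_dvd.mp heven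
  have hm0 : m ≠ 0 := by rintro rfl; exact hΔ0 (Int.natAbs_eq_zero.mp (by simpa using hm))
  have hdiv : a.curveInt.Δ.natAbs / 2 = m := by rw [hm]; simp
  have hsqm : Squarefree m := fun x hx ↦ hsqn x (dvd_trans hx ⟨2, by rw [hm]; ring⟩)
  have hss := forall_not_dvd_c₄_of_squarefree hsq
  -- `J(c₄ | m) = 1`: the primes of `m` divide `Δ`
  have hJ : J(a.curveInt.c₄ | m) = 1 := by
    refine jacobiSym_eq_one_of_forall_legendreSym_eq_one hm0 fun p hp hpm ↦ ?_
    haveI : Fact p.Prime := ⟨hp⟩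
    have hpΔ : (p : ℤ) ∣ a.curveInt.Δ :=
      Int.natCast_dvd.mpr (dvd_trans hpm ⟨2, by rw [hm]; ring⟩)
    exact legendreSym_c₄_eq_one hpΔ (hss p hp hpΔ)
  rw [rootNumber_curve_eq_liouville_mul_jacobiSym_of_even a hsq heven hmod, hdiv,
    moebius_eq_neg_one_pow_card_primeFactors hsqm,
    show -(a.curveInt.c₄ * a.curveInt.c₆) = a.curveInt.c₄ * -a.curveInt.c₆ by ring,
    jacobiSym.mul_left, hJ, one_mul]

/-- **Uniform normal form, odd case** (restated for members of `F₂`): for squarefree odd `Δ(a)`,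
`w(E_a) = −μ(|Δ(a)|)·J(−c₆(a) | |Δ(a)|)` (modulo Modularity). [cite: Rohrlich1993Compositio, Prop. 2(ii)]
[cite: Helfgott2004RootNumber, §1] -/
theorem rootNumber_curve_eq_neg_moebius_mul_jacobiSym_of_odd (a : Params)
    (hsq : Squarefree a.curveInt.Δ) (hodd : ¬ (2 : ℤ) ∣ a.curveInt.Δ)
    (hmod : Literature.NumberTheory.EllipticCurves.ModularForms.exists_isNewformOf) :
    a.curve.rootNumber =
      -(ArithmeticFunction.moebius a.curveInt.Δ.natAbs * J(-a.curveInt.c₆ | a.curveInt.Δ.natAbs)) := by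
  rw [curve_eq_baseChange, rootNumber_eq_neg_moebius_mul_jacobiSym_neg_c₆ hsq hodd hmod]

end Summit.BirchSwinnertonDyer.BirchSwinnertonDyer.Theorems.F2RootNumber

end
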